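import Literature.AlgebraicGeometry.Motives.KaehlerTopologyProofs
import Literature.AlgebraicGeometry.Motives.DeRhamComparisonProofs
import Literature.AlgebraicGeometry.Motives.HodgeDecompositionIsInternalDischarge
import Literature.AlgebraicGeometry.Motives.HodgeDecompositionDolbeaultComparisonDischarge
import Literature.NumberTheory.Transcendental.ComplexDeRhamHolds
import Literature.NumberTheory.Transcendental.KaehlerHodgeSymmDischarge
import HarnessLib

/-!
# Odd Betti numbers of compact Kähler manifolds are even (discharge of `even_bettiNumber_of_odd`)

Trunk **T-KAEHLER** (`AlgebraicGeometry/Motives`). Theorems-only leaf companion of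
`KaehlerTopology.lean` (the named fact `Literature.AlgebraicGeometry.Motives.even_bettiNumber_of_odd E`:
for a compact Hausdorff complex manifold `M` charted on `E` with `[IsKaehlerManifold E M]`, every odd
Betti number `b_k(M; ℚ)` is even; W. V. D. Hodge (1941); C. Voisin, *Hodge Theory and Complex
Algebraic Geometry I* (2002), §6.1.3 Cor. 6.13 ("the odd Betti numbers `b_{2k+1}(X)` are even");
P. Griffiths, J. Harris, *Principles of Algebraic Geometry* (1978), p. 117) and of its reduction file
`KaehlerTopologyProofs.lean`, whose `even_bettiNumber_of_odd_of` reduces the fact to three named facts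
quantified over the smooth metrics `g` of `M`, all three now THEOREMS of the tree:

* `hH g : sum_hodgeNumber_eq_finrank_complexDeRham g` — `∑_{p+q=k} h^{p,q} = dim_ℂ H^k_dR(M; ℂ)` for
  Kähler `g` (hodge.S07): `sum_hodgeNumber_eq_finrank_complexDeRham_of_isInternal_of_exists_equiv'`
  (`DeRhamComparisonProofs.lean`) fed `isInternal_hodgePQ_holds`
  (`HodgeDecompositionIsInternalDischarge.lean`) and `exists_hodgePQ_equiv_dolbeaultCohomology_holds`
  (`HodgeDecompositionDolbeaultComparisonDischarge.lean`);
* `hdR k : finrank_complexDeRham_eq_bettiNumber E M k` — de Rham's theorem with universal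
  coefficients: `finrank_complexDeRham_eq_bettiNumber_holds` (`Transcendental/ComplexDeRhamHolds.lean`);
* `hS g : hodgeNumber_symm g` — Hodge symmetry `h^{p,q} = h^{q,p}` (Voisin Cor. 6.12):
  `hodgeNumber_symm_holds` (`KaehlerHodgeSymmDischarge.lean`).

* **`even_bettiNumber_of_odd_holds`** — discharge of the named fact (the one-liner its docstring
  prescribes: "`even_bettiNumber_of_odd_holds` is that theorem fed the three `…_holds` once they
  exist").
* `even_bettiNumber_rat_of_odd` — binder form, `Even (b_k(M; ℚ))` for odd `k`.

Status note for the facts census: the `def` was restated on 2026-08-15 WITH the binders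
`[T2Space M] [CompactSpace M]`; the refutation on record, `not_even_bettiNumber_of_odd_puncturedPlane`
(`KaehlerTopologyPuncturedPlane.lean`, the punctured plane, `b₁ = 1`), is kept there UNFOLDED and
concerns the old compactness-free family only — it does not mention the present `def`, which this file
proves.

No definition and no named fact is introduced (D-0026).

## References

* C. Voisin, *Hodge Theory and Complex Algebraic Geometry I* (2002), §6.1.3 Cor. 6.12, Cor. 6.13.
  [VoisinHodgeI2002] [Voisin2002]
* W. V. D. Hodge, *The Theory and Applications of Harmonic Integrals* (1941), Ch. IV.
  [HodgeHarmonicIntegrals1941]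
* P. Griffiths, J. Harris, *Principles of Algebraic Geometry* (1978), p. 117. [GriffithsHarris1978]
-/

noncomputable section

open scoped Manifold ContDiff
open Module Literature.Geometry.Kaehler Literature.NumberTheory.Transcendental

namespace Literature.AlgebraicGeometry.Motives

universe u

variable {E : Type} [NormedAddCommGroup E] [NormedSpace ℂ E] [FiniteDimensional ℂ E]
  {M : Type u} [TopologicalSpace M] [ChartedSpace E M] [IsManifold 𝓘(ℂ, E) ω M]
  [IsManifold 𝓘(ℝ, E) ∞ M] [T2Space M] [CompactSpace M]

/-- **Odd Betti numbers of a compact Kähler manifold are even** (discharge of the named fact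
`even_bettiNumber_of_odd E`; Voisin (2002), Cor. 6.13): for `M` compact Hausdorff with
`[IsKaehlerManifold E M]` and `k` odd, `b_k(M; ℚ)` is even. The tree's reduction
`even_bettiNumber_of_odd_of` (pick a Kähler metric; `b_k(M; ℚ) = b_k(M; ℂ) = dim H^k_dR(M; ℂ)
= ∑_{p+q=k} h^{p,q}`, even by `h^{p,q} = h^{q,p}`, `even_sum_antidiagonal_of_symm`) fed the three
theorems listed in the module docstring. [cite: VoisinHodgeI2002, §6.1.3 Cor. 6.13] -/
theorem even_bettiNumber_of_odd_holds : even_bettiNumber_of_odd E (M := M) :=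
  even_bettiNumber_of_odd_of
    (fun g ↦ sum_hodgeNumber_eq_finrank_complexDeRham_of_isInternal_of_exists_equiv'
      isInternal_hodgePQ_holds exists_hodgePQ_equiv_dolbeaultCohomology_holds g)
    (fun k ↦ finrank_complexDeRham_eq_bettiNumber_holds E M k)
    (fun g ↦ hodgeNumber_symm_holds g)

variable (E) in
/-- **`b_k(M; ℚ)` is even for odd `k`** on a compact Kähler manifold, binder form of
`even_bettiNumber_of_odd_holds` (the model space `E` explicit, as it is not determined by the
conclusion). [cite: VoisinHodgeI2002, §6.1.3 Cor. 6.13] -/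
theorem even_bettiNumber_rat_of_odd [IsKaehlerManifold E M] {k : ℕ} (hk : Odd k) :
    Even (Literature.AlgebraicTopology.SingularHomology.bettiNumber ℚ M k) :=
  even_bettiNumber_of_odd_holds (E := E) (M := M) hk

end Literature.AlgebraicGeometry.Motives

end
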